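import Summits.QuantumFields.BalabanUV.T4Continuum.Support.SkeletonFillFull
import Summits.QuantumFields.BalabanUV.T4Continuum.Support.GaugeFieldPerturbation

/-!
# T⁴ programme, node NE3 — kinematic refinement lemma, leaf R1c∕R1d (row NE3-S4d), file F3a: NEAR-IDENTITY CALCULUS FOR
# THE CLOSED-FORM FILLING; the plaquette deviations INSIDE a block (`≤ a₀ + 2θ²`) and ACROSS THE FAR FACE IN `μ`
# (`≤ a₀ + 2θ² + 2θθ_L + d(L−1)δ`)

Cell `pub-balaban`, NE3 formalisation swarm, unit `b2b-balaban-t4-ne3-formalise-leaf-07` (LEAF PROVER 07), row **S4d** of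
`t4/formal/NE3/LEAVES.md`; companion of `SkeletonFillFull` (F2: the closed form `fullFill L T h` and its four plaquette
words); SHAPE `t4/formal/NE3/Statements/S4d-SHAPE-v1.md` §3.  MECHANISM: in the words of F2 every factor is a unitary close
to `1` EXCEPT the chain data `T`, which occur only as conjugations `T·(…)·T⁻¹` of the neighbouring block's row products or
(case IV) through the chain plaquette `T(∂p) = h^{L²}`; after transporting the neighbour's roots by `Ad_T` every word is a
product of near-identity unitaries whose ABELIAN reading is one root `h(z;μ,ν)`; the deviation is paid in COMMUTATORS
(second order in `a₀`) and in the COVARIANT ROOT GRADIENT `δ ≥ ‖Ad_{T(z,μ)} h(z+e_μ;κ,ν) − h(z;κ,ν)‖` («O(∇F∕L² + a²)»).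
CONTENT (all [folklore]; `Matrix n n ℂ`; 0 sorry): §1 unitary-word calculus; §2 SIZES `‖Hμ − 1‖ ≤ d(L−1)a₀ =: θ`,
`‖Lμ − 1‖ ≤ d(L−1)L a₀ =: θ_L`, transported difference `≤ d(L−1)δ`; §3 **`norm_plaq_inner_sub_one_le`** (case I),
**`norm_plaq_farμ_sub_one_le`** (case II).  Cases III–IV and the `SmallField` assembly: files F3b∕F3c.
HONEST FRAMING.  Norm bookkeeping for a kinematic construction; no minimiser, no conditional of the cell (`BetaPertH`, (B),
(B^μ)); nothing bears on infinite volume, a mass gap, or the Clay problem; **NE3 is NOT proved** (one leaf of the kinematic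
lemma `SmoothRefine` ∕ `ApproxRefine`, ours, unproved).  Finite T⁴ rung (B)+1.  ABSOLUTE RULE kept: no printed sentence is a
hypothesis; no `def … : Prop` fact; no `sorry`, axioms ⊆ {propext, Classical.choice, Quot.sound}.  PLACEMENT (human rule
2026-08-19): under `Summits/QuantumFields/BalabanUV/`; imports F2 and row R0's generic toolkit `GaugeFieldPerturbation`
(leaf-09) only; moves nothing.
-/

set_option autoImplicit false

open scoped BigOperators Matrix Matrix.Norms.L2Operator
open NormedSpace

namespace Summit.QuantumFields.BalabanUV.T4Continuum.SkeletonFillFullNorms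

open Literature.MathematicalPhysics.QuantumFieldTheory.Balaban1983to89
open B7Prop1Explicit B7Prop2Explicit B7Prop1Local MatrixLog UnitaryModel
open T4AveragingDeficitWall hiding Site Plane Plaq Bond
open T4AveragingDeficitNonAbelian (Ad_mul Ad_sub)
open AveragingDeficitTransport AveragingDeficitNearIdentity GaugeFieldPerturbation
open SkeletonLattice SkeletonFill SkeletonFillFull

noncomputable section

variable {d : ℕ} {n : Type*} [Fintype n] [DecidableEq n]

/-! ## §1 Unitary-word calculus -/
section Words

variable {G : Type*} [Group G]

/-- **SPLITTING AN ORDERED PRODUCT AT ONE INDEX** `ν ∈ l` (duplicate-free): `Π_l f = Π_{l₁} f · f ν · Π_{l₂} f`. [folklore] -/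
theorem prodOver_split {l : List (Fin d)} (hl : l.Nodup) {ν : Fin d} (hν : ν ∈ l) :
    ∃ l₁ l₂ : List (Fin d), l = l₁ ++ ν :: l₂ ∧ ν ∉ l₁ ∧ ν ∉ l₂ ∧
      ∀ f : Fin d → G, prodOver l f = prodOver l₁ f * f ν * prodOver l₂ f := by
  obtain ⟨l₁, l₂, rfl⟩ := List.append_of_mem hν
  have h := List.nodup_middle.mp hl
  rw [List.nodup_cons, List.mem_append, not_or] at h
  refine ⟨l₁, l₂, rfl, h.1.1, h.1.2, fun f => ?_⟩
  simp only [prodOver, List.map_append, List.map_cons, List.prod_append, List.prod_cons, mul_assoc]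

/-- Conjugation passes through ordered products factor by factor. [folklore] -/
theorem conj_prodOver (t : G) (l : List (Fin d)) (f : Fin d → G) :
    t * prodOver l f * t⁻¹ = prodOver l fun i => t * f i * t⁻¹ := by
  have h := map_list_prod (MulAut.conj t) (l.map f)
  simp only [MulAut.conj_apply, List.map_map] at h
  simpa [prodOver, Function.comp_def] using h

/-- Conjugation passes through powers: `t u^k t⁻¹ = (t u t⁻¹)^k`. [folklore] -/
theorem conj_pow (t u : G) (k : ℕ) : t * u ^ k * t⁻¹ = (t * u * t⁻¹) ^ k := by
  induction k with
  | zero => simp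
  | succ k ih => rw [pow_succ, pow_succ, ← ih]; group
/-- Conjugation passes through powers and inverses: `t (u^k)⁻¹ t⁻¹ = ((t u t⁻¹)^k)⁻¹`. [folklore] -/
theorem conj_pow_inv (t u : G) (k : ℕ) : t * (u ^ k)⁻¹ * t⁻¹ = ((t * u * t⁻¹) ^ k)⁻¹ := by
  rw [← conj_pow]; group

end Words

section Norms
/-- A unitary unit has norm `1`. [folklore] -/
theorem norm_val_of_unitary [Nonempty n] {u : (Matrix n n ℂ)ˣ} (hu : u ∈ unitaryUnits (Matrix n n ℂ)) : ‖(u : (Matrix n n ℂ))‖ = 1 :=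
  CStarRing.norm_of_mem_unitary (mem_unitaryUnits.mp hu)

/-- Left frame: `‖u x − u y‖ = ‖x − y‖` for unitary `u`. [folklore] -/
theorem norm_val_mul_left_sub {u : (Matrix n n ℂ)ˣ} (hu : u ∈ unitaryUnits (Matrix n n ℂ)) (x y : (Matrix n n ℂ)ˣ) :
    ‖((u * x : (Matrix n n ℂ)ˣ) : (Matrix n n ℂ)) - ((u * y : (Matrix n n ℂ)ˣ) : (Matrix n n ℂ))‖ = ‖(x : (Matrix n n ℂ)) - (y : (Matrix n n ℂ))‖ := by
  rw [Units.val_mul, Units.val_mul, ← mul_sub, CStarRing.norm_mem_unitary_mul _ (mem_unitaryUnits.mp hu)]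

/-- Right frame: `‖x u − y u‖ = ‖x − y‖` for unitary `u`. [folklore] -/
theorem norm_val_mul_right_sub {u : (Matrix n n ℂ)ˣ} (hu : u ∈ unitaryUnits (Matrix n n ℂ)) (x y : (Matrix n n ℂ)ˣ) :
    ‖((x * u : (Matrix n n ℂ)ˣ) : (Matrix n n ℂ)) - ((y * u : (Matrix n n ℂ)ˣ) : (Matrix n n ℂ))‖ = ‖(x : (Matrix n n ℂ)) - (y : (Matrix n n ℂ))‖ := by
  rw [Units.val_mul, Units.val_mul, ← sub_mul, CStarRing.norm_mul_mem_unitary _ (mem_unitaryUnits.mp hu)]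

/-- Two-sided frame: `‖p x s − p y s‖ = ‖x − y‖` for unitary `p, s`. [folklore] -/
theorem norm_val_frame_sub {p s : (Matrix n n ℂ)ˣ} (hp : p ∈ unitaryUnits (Matrix n n ℂ)) (hs : s ∈ unitaryUnits (Matrix n n ℂ)) (x y : (Matrix n n ℂ)ˣ) :
    ‖((p * x * s : (Matrix n n ℂ)ˣ) : (Matrix n n ℂ)) - ((p * y * s : (Matrix n n ℂ)ˣ) : (Matrix n n ℂ))‖ = ‖(x : (Matrix n n ℂ)) - (y : (Matrix n n ℂ))‖ := by
  rw [norm_val_mul_right_sub hs, norm_val_mul_left_sub hp]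

/-- `‖u⁻¹ − 1‖ = ‖u − 1‖` for unitary `u`. [folklore] -/
theorem norm_val_inv_sub_one {u : (Matrix n n ℂ)ˣ} (hu : u ∈ unitaryUnits (Matrix n n ℂ)) : ‖((u⁻¹ : (Matrix n n ℂ)ˣ) : (Matrix n n ℂ)) - 1‖ = ‖(u : (Matrix n n ℂ)) - 1‖ := by
  have h : ((u⁻¹ : (Matrix n n ℂ)ˣ) : (Matrix n n ℂ)) - 1 = ((u⁻¹ : (Matrix n n ℂ)ˣ) : (Matrix n n ℂ)) * (1 - (u : (Matrix n n ℂ))) := by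
    rw [mul_sub, mul_one, Units.inv_mul]
  rw [h, CStarRing.norm_mem_unitary_mul _ (mem_unitaryUnits.mp ((unitaryUnits (Matrix n n ℂ)).inv_mem hu)), norm_sub_rev]

/-- `‖u⁻¹ − v⁻¹‖ = ‖u − v‖` for unitaries. [folklore] -/
theorem norm_val_inv_sub_inv {u v : (Matrix n n ℂ)ˣ} (hu : u ∈ unitaryUnits (Matrix n n ℂ)) (hv : v ∈ unitaryUnits (Matrix n n ℂ)) :
    ‖((u⁻¹ : (Matrix n n ℂ)ˣ) : (Matrix n n ℂ)) - ((v⁻¹ : (Matrix n n ℂ)ˣ) : (Matrix n n ℂ))‖ = ‖(u : (Matrix n n ℂ)) - (v : (Matrix n n ℂ))‖ := by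
  have h : ((u⁻¹ : (Matrix n n ℂ)ˣ) : (Matrix n n ℂ)) - ((v⁻¹ : (Matrix n n ℂ)ˣ) : (Matrix n n ℂ)) = ((u⁻¹ : (Matrix n n ℂ)ˣ) : (Matrix n n ℂ)) * ((v : (Matrix n n ℂ)) - (u : (Matrix n n ℂ))) * ((v⁻¹ : (Matrix n n ℂ)ˣ) : (Matrix n n ℂ)) := by
    rw [mul_sub, sub_mul, Units.inv_mul, one_mul, mul_assoc, Units.mul_inv, mul_one]
  rw [h, CStarRing.norm_mul_mem_unitary _ (mem_unitaryUnits.mp ((unitaryUnits (Matrix n n ℂ)).inv_mem hv)),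
    CStarRing.norm_mem_unitary_mul _ (mem_unitaryUnits.mp ((unitaryUnits (Matrix n n ℂ)).inv_mem hu)), norm_sub_rev]

/-- **COMMUTATOR BOUND**: `‖xy − yx‖ ≤ 2‖x − 1‖‖y − 1‖` (`xy − yx = (x−1)(y−1) − (y−1)(x−1)`). [folklore] -/
theorem norm_comm_le (x y : (Matrix n n ℂ)) : ‖x * y - y * x‖ ≤ 2 * ‖x - 1‖ * ‖y - 1‖ := by
  have h : x * y - y * x = (x - 1) * (y - 1) - (y - 1) * (x - 1) := by noncomm_ring
  rw [h]
  calc _ ≤ ‖(x - 1) * (y - 1)‖ + ‖(y - 1) * (x - 1)‖ := norm_sub_le _ _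
    _ ≤ ‖x - 1‖ * ‖y - 1‖ + ‖y - 1‖ * ‖x - 1‖ := add_le_add (norm_mul_le _ _) (norm_mul_le _ _)
    _ = 2 * ‖x - 1‖ * ‖y - 1‖ := by ring

/-- **CONJUGATION BOUND**: `‖u y u⁻¹ − y‖ ≤ 2‖u − 1‖‖y − 1‖` for unitary `u`. [folklore] -/
theorem norm_val_conj_sub_le [Nonempty n] {u : (Matrix n n ℂ)ˣ} (hu : u ∈ unitaryUnits (Matrix n n ℂ)) (y : (Matrix n n ℂ)ˣ) :
    ‖((u * y * u⁻¹ : (Matrix n n ℂ)ˣ) : (Matrix n n ℂ)) - (y : (Matrix n n ℂ))‖ ≤ 2 * ‖(u : (Matrix n n ℂ)) - 1‖ * ‖(y : (Matrix n n ℂ)) - 1‖ := by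
  have h := norm_Ad_sub_le hu ((y : (Matrix n n ℂ)) - 1)
  have e : Ad u ((y : (Matrix n n ℂ)) - 1) - ((y : (Matrix n n ℂ)) - 1) = ((u * y * u⁻¹ : (Matrix n n ℂ)ˣ) : (Matrix n n ℂ)) - (y : (Matrix n n ℂ)) := by
    simp only [Ad, Units.val_mul, mul_sub, sub_mul, mul_one, Units.mul_inv]; abel
  rwa [e] at h

/-- **THE PLAQUETTE FRAME**: `‖A M A′⁻¹ N⁻¹ − 1‖ = ‖A M − N A′‖` for unitary `A′, N`. [folklore] -/
theorem norm_val_plaq4_sub_one {A M A' N : (Matrix n n ℂ)ˣ} (hA' : A' ∈ unitaryUnits (Matrix n n ℂ)) (hN : N ∈ unitaryUnits (Matrix n n ℂ)) :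
    ‖((A * M * A'⁻¹ * N⁻¹ : (Matrix n n ℂ)ˣ) : (Matrix n n ℂ)) - 1‖ = ‖((A * M : (Matrix n n ℂ)ˣ) : (Matrix n n ℂ)) - ((N * A' : (Matrix n n ℂ)ˣ) : (Matrix n n ℂ))‖ := by
  have e : (A * M * A'⁻¹ * N⁻¹ : (Matrix n n ℂ)ˣ) = (A * M) * (N * A')⁻¹ := by group
  have h1 : ((A * M * A'⁻¹ * N⁻¹ : (Matrix n n ℂ)ˣ) : (Matrix n n ℂ)) - 1
      = (((A * M : (Matrix n n ℂ)ˣ) : (Matrix n n ℂ)) - ((N * A' : (Matrix n n ℂ)ˣ) : (Matrix n n ℂ))) * (((N * A')⁻¹ : (Matrix n n ℂ)ˣ) : (Matrix n n ℂ)) := by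
    rw [e, Units.val_mul, sub_mul, Units.mul_inv]
  rw [h1, CStarRing.norm_mul_mem_unitary _
    (mem_unitaryUnits.mp ((unitaryUnits (Matrix n n ℂ)).inv_mem ((unitaryUnits (Matrix n n ℂ)).mul_mem hN hA')))]

/-- **ORDERED PRODUCTS OF NEAR-IDENTITY UNITARIES**: `‖Π_l f − 1‖ ≤ |l|·c` (factors unitary within `c` of `1`). [folklore] -/
theorem norm_val_prodOver_sub_one_le [Nonempty n] {l : List (Fin d)} {f : Fin d → (Matrix n n ℂ)ˣ} (hf : ∀ i ∈ l, f i ∈ unitaryUnits (Matrix n n ℂ))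
    {c : ℝ} (hc : ∀ i ∈ l, ‖(f i : (Matrix n n ℂ)) - 1‖ ≤ c) : ‖((prodOver l f : (Matrix n n ℂ)ˣ) : (Matrix n n ℂ)) - 1‖ ≤ l.length * c := by
  induction l with
  | nil => simp
  | cons a l ih =>
    rw [prodOver_cons, Units.val_mul, List.length_cons, Nat.cast_succ, add_mul, one_mul, add_comm]
    refine (B8Ineq170.norm_mul_sub_one_le_of_norm_le_one (norm_val_of_unitary (hf a (by simp))).le).trans ?_
    exact add_le_add (hc a (by simp)) (ih (fun i hi => hf i (by simp [hi])) (fun i hi => hc i (by simp [hi])))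

/-- **POWERS**: `‖u^k − 1‖ ≤ k‖u − 1‖` for unitary `u`. [folklore] -/
theorem norm_val_pow_sub_one_le [Nonempty n] {u : (Matrix n n ℂ)ˣ} (hu : u ∈ unitaryUnits (Matrix n n ℂ)) (k : ℕ) :
    ‖((u ^ k : (Matrix n n ℂ)ˣ) : (Matrix n n ℂ)) - 1‖ ≤ k * ‖(u : (Matrix n n ℂ)) - 1‖ := by
  induction k with
  | zero => simp
  | succ k ih =>
    rw [pow_succ, Units.val_mul, Nat.cast_succ, add_mul, one_mul]
    exact (B8Ineq170.norm_mul_sub_one_le_of_norm_le_one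
      (norm_val_of_unitary ((unitaryUnits (Matrix n n ℂ)).pow_mem hu k)).le).trans (add_le_add ih le_rfl)

/-- **ORDERED PRODUCTS, DIFFERENCE**: `‖Π_l f − Π_l g‖ ≤ |l|·c` (unitary factors, `‖f_i − g_i‖ ≤ c`). [folklore] -/
theorem norm_val_prodOver_sub_prodOver_le [Nonempty n] {l : List (Fin d)} {f g : Fin d → (Matrix n n ℂ)ˣ}
    (hf : ∀ i ∈ l, f i ∈ unitaryUnits (Matrix n n ℂ)) (hg : ∀ i ∈ l, g i ∈ unitaryUnits (Matrix n n ℂ)) {c : ℝ}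
    (hc : ∀ i ∈ l, ‖(f i : (Matrix n n ℂ)) - (g i : (Matrix n n ℂ))‖ ≤ c) :
    ‖((prodOver l f : (Matrix n n ℂ)ˣ) : (Matrix n n ℂ)) - ((prodOver l g : (Matrix n n ℂ)ˣ) : (Matrix n n ℂ))‖ ≤ l.length * c := by
  induction l with
  | nil => simp
  | cons a l ih =>
    rw [prodOver_cons, prodOver_cons, Units.val_mul, Units.val_mul, List.length_cons, Nat.cast_succ, add_mul, one_mul,
      add_comm]
    refine (norm_mul_sub_mul_le_of_norm_le_one (norm_val_of_unitary (prodOver_mem fun i hi => hf i (by simp [hi]))).le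
      (norm_val_of_unitary (hg a (by simp))).le).trans ?_
    exact add_le_add (hc a (by simp)) (ih (fun i hi => hf i (by simp [hi])) (fun i hi => hg i (by simp [hi]))
      (fun i hi => hc i (by simp [hi])))

/-- **POWERS, DIFFERENCE**: `‖u^k − v^k‖ ≤ k‖u − v‖` for unitaries. [folklore] -/
theorem norm_val_pow_sub_pow_le [Nonempty n] {u v : (Matrix n n ℂ)ˣ} (hu : u ∈ unitaryUnits (Matrix n n ℂ)) (hv : v ∈ unitaryUnits (Matrix n n ℂ)) (k : ℕ) :
    ‖((u ^ k : (Matrix n n ℂ)ˣ) : (Matrix n n ℂ)) - ((v ^ k : (Matrix n n ℂ)ˣ) : (Matrix n n ℂ))‖ ≤ k * ‖(u : (Matrix n n ℂ)) - (v : (Matrix n n ℂ))‖ := by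
  induction k with
  | zero => simp
  | succ k ih =>
    rw [pow_succ, pow_succ, Units.val_mul, Units.val_mul, Nat.cast_succ, add_mul, one_mul]
    exact (norm_mul_sub_mul_le_of_norm_le_one (norm_val_of_unitary hu).le
      (norm_val_of_unitary ((unitaryUnits (Matrix n n ℂ)).pow_mem hv k)).le).trans (add_le_add ih le_rfl)

end Norms
/-! ## §2 Sizes of the row and compensating products; transported differences -/
section Sizes

variable [Nonempty n] {L : ℕ} {a₀ δ : ℝ}

omit [Fintype n] [DecidableEq n] [Nonempty n] in
/-- Offsets in the box have `toNat ≤ L − 1`. [folklore] -/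
theorem toNat_le_of_inBox {q : Site d} (hq : InBox L q) (i : Fin d) : (q i).toNat ≤ L - 1 := by
  have := (hq i).2; have := (hq i).1; omega

/-- **SIZE OF THE ROW PRODUCT**: `‖Hμ(z,q) − 1‖ ≤ d(L−1)a₀` for `q` in the box and roots within `a₀` of `1`. [folklore] -/
theorem norm_hiProd_sub_one_le {h : Site d → Fin d → Fin d → (Matrix n n ℂ)ˣ}
    (hh : ∀ (z : Site d) (κ ν : Fin d), h z κ ν ∈ unitaryUnits (Matrix n n ℂ))
    (ha : ∀ (z : Site d) (κ ν : Fin d), κ < ν → ‖((h z κ ν : (Matrix n n ℂ)ˣ) : (Matrix n n ℂ)) - 1‖ ≤ a₀) (ha0 : 0 ≤ a₀) (z : Site d) {q : Site d} (hq : InBox L q)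
    (μ : Fin d) : ‖((hiProd h z q μ : (Matrix n n ℂ)ˣ) : (Matrix n n ℂ)) - 1‖ ≤ d * ((L - 1 : ℕ) * a₀) := by
  have hlen : ((above μ).length : ℝ) ≤ d := by
    have := List.length_filter_le (fun ν => decide (μ < ν)) (List.finRange d); simp_all [above]
  refine (norm_val_prodOver_sub_one_le (fun ν _ => (unitaryUnits (Matrix n n ℂ)).inv_mem ((unitaryUnits (Matrix n n ℂ)).pow_mem (hh _ _ _) _))
    (c := (L - 1 : ℕ) * a₀) (fun ν hν => ?_)).trans (mul_le_mul_of_nonneg_right hlen (by positivity))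
  rw [norm_val_inv_sub_one ((unitaryUnits (Matrix n n ℂ)).pow_mem (hh _ _ _) _)]
  refine (norm_val_pow_sub_one_le (hh _ _ _) _).trans ?_
  exact mul_le_mul (by exact_mod_cast toNat_le_of_inBox hq ν) (ha _ _ _ (mem_above.mp hν)) (norm_nonneg _)
    (by positivity)

/-- **SIZE OF THE COMPENSATING PRODUCT**: `‖Lμ(z,q) − 1‖ ≤ d(L−1)L a₀`. [folklore] -/
theorem norm_loProd_sub_one_le {h : Site d → Fin d → Fin d → (Matrix n n ℂ)ˣ}
    (hh : ∀ (z : Site d) (κ ν : Fin d), h z κ ν ∈ unitaryUnits (Matrix n n ℂ))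
    (ha : ∀ (z : Site d) (κ ν : Fin d), κ < ν → ‖((h z κ ν : (Matrix n n ℂ)ˣ) : (Matrix n n ℂ)) - 1‖ ≤ a₀) (ha0 : 0 ≤ a₀) (z : Site d) {q : Site d} (hq : InBox L q)
    (μ : Fin d) : ‖((loProd L h z q μ : (Matrix n n ℂ)ˣ) : (Matrix n n ℂ)) - 1‖ ≤ d * (((L - 1 : ℕ) * L) * a₀) := by
  have hlen : ((below μ).length : ℝ) ≤ d := by
    have := List.length_filter_le (fun κ => decide (κ < μ)) (List.finRange d); simp_all [below]
  refine (norm_val_prodOver_sub_one_le (fun κ _ => (unitaryUnits (Matrix n n ℂ)).pow_mem (hh _ _ _) _)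
    (c := ((L - 1 : ℕ) * L) * a₀) (fun κ hκ => ?_)).trans (mul_le_mul_of_nonneg_right hlen (by positivity))
  refine (norm_val_pow_sub_one_le (hh _ _ _) _).trans ?_
  push_cast
  exact mul_le_mul (by exact_mod_cast Nat.mul_le_mul_right L (toNat_le_of_inBox hq κ)) (ha _ _ _ (mem_below.mp hκ))
    (norm_nonneg _) (by positivity)

/-- **TRANSPORTED DIFFERENCE OF ROW PRODUCTS**: `‖t·Hν(z′,q)·t⁻¹ − Hν(z,q)‖ ≤ d(L−1)δ` when every transported root
`t h(z′;κ,ι) t⁻¹` is within `δ` of `h(z;κ,ι)` (`t` = the chain datum). [folklore] -/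
theorem norm_conj_hiProd_sub_le {h : Site d → Fin d → Fin d → (Matrix n n ℂ)ˣ}
    (hh : ∀ (z : Site d) (κ ν : Fin d), h z κ ν ∈ unitaryUnits (Matrix n n ℂ)) {t : (Matrix n n ℂ)ˣ} (ht : t ∈ unitaryUnits (Matrix n n ℂ))
    {z z' : Site d} (hδ : ∀ κ ν : Fin d, κ < ν → ‖((t * h z' κ ν * t⁻¹ : (Matrix n n ℂ)ˣ) : (Matrix n n ℂ)) - ((h z κ ν : (Matrix n n ℂ)ˣ) : (Matrix n n ℂ))‖ ≤ δ) (hδ0 : 0 ≤ δ)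
    {q : Site d} (hq : InBox L q) (ν : Fin d) :
    ‖((t * hiProd h z' q ν * t⁻¹ : (Matrix n n ℂ)ˣ) : (Matrix n n ℂ)) - ((hiProd h z q ν : (Matrix n n ℂ)ˣ) : (Matrix n n ℂ))‖ ≤ d * ((L - 1 : ℕ) * δ) := by
  have hlen : ((above ν).length : ℝ) ≤ d := by
    have := List.length_filter_le (fun ι => decide (ν < ι)) (List.finRange d); simp_all [above]
  unfold hiProd
  rw [conj_prodOver]
  simp only [conj_pow_inv]
  have htu : ∀ κ ι : Fin d, t * h z' κ ι * t⁻¹ ∈ unitaryUnits (Matrix n n ℂ) := fun κ ι =>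
    (unitaryUnits (Matrix n n ℂ)).mul_mem ((unitaryUnits (Matrix n n ℂ)).mul_mem ht (hh _ _ _)) ((unitaryUnits (Matrix n n ℂ)).inv_mem ht)
  refine (norm_val_prodOver_sub_prodOver_le
    (fun ι _ => (unitaryUnits (Matrix n n ℂ)).inv_mem ((unitaryUnits (Matrix n n ℂ)).pow_mem (htu _ _) _))
    (fun ι _ => (unitaryUnits (Matrix n n ℂ)).inv_mem ((unitaryUnits (Matrix n n ℂ)).pow_mem (hh _ _ _) _))
    (c := (L - 1 : ℕ) * δ) (fun ι hι => ?_)).trans (mul_le_mul_of_nonneg_right hlen (by positivity))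
  rw [norm_val_inv_sub_inv ((unitaryUnits (Matrix n n ℂ)).pow_mem (htu _ _) _) ((unitaryUnits (Matrix n n ℂ)).pow_mem (hh _ _ _) _)]
  refine (norm_val_pow_sub_pow_le (htu _ _) (hh _ _ _) _).trans ?_
  exact mul_le_mul (by exact_mod_cast toNat_le_of_inBox hq ι) (hδ _ _ (mem_above.mp hι)) (norm_nonneg _)
    (by positivity)

end Sizes
/-! ## §3 The plaquette deviations: inside a block (case I) and across one far face in `μ` (case II) -/
section Plaquettes

variable [Nonempty n] {L : ℕ} {a₀ δ : ℝ}

omit [Nonempty n] in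
/-- One more row factor: `‖(g^k)⁻¹ − (g^{k+1})⁻¹‖ = ‖g − 1‖` for unitary `g` (`(g^k)⁻¹ = (g^{k+1})⁻¹ g`). [folklore] -/
theorem norm_val_powInv_sub_powInv_succ {g : (Matrix n n ℂ)ˣ} (hg : g ∈ unitaryUnits (Matrix n n ℂ)) (k : ℕ) :
    ‖(((g ^ k)⁻¹ : (Matrix n n ℂ)ˣ) : (Matrix n n ℂ)) - (((g ^ (k + 1))⁻¹ : (Matrix n n ℂ)ˣ) : (Matrix n n ℂ))‖ = ‖(g : (Matrix n n ℂ)) - 1‖ := by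
  have e1 : ((g ^ k)⁻¹ : (Matrix n n ℂ)ˣ) = (g ^ (k + 1))⁻¹ * g := by rw [pow_succ]; group
  have e2 : (((g ^ k)⁻¹ : (Matrix n n ℂ)ˣ) : (Matrix n n ℂ)) - (((g ^ (k + 1))⁻¹ : (Matrix n n ℂ)ˣ) : (Matrix n n ℂ))
      = (((g ^ (k + 1))⁻¹ : (Matrix n n ℂ)ˣ) : (Matrix n n ℂ)) * ((g : (Matrix n n ℂ)) - 1) := by
    rw [e1, Units.val_mul, mul_sub, mul_one]
  rw [e2, CStarRing.norm_mem_unitary_mul _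
    (mem_unitaryUnits.mp ((unitaryUnits (Matrix n n ℂ)).inv_mem ((unitaryUnits (Matrix n n ℂ)).pow_mem hg _)))]

omit [Fintype n] [DecidableEq n] [Nonempty n] in
/-- The offset one step up in `ν` has `toNat` one larger there. [folklore] -/
theorem toNat_add_e_self {q : Site d} {ν : Fin d} (h0 : 0 ≤ q ν) : ((q + e ν) ν).toNat = (q ν).toNat + 1 := by
  simp only [Pi.add_apply, e_apply, if_true]
  omega

omit [Nonempty n] in
/-- **THE ROW STEP**: `‖Hμ(z,q) − Hμ(z,q+e_ν)‖ = ‖h(z;μ,ν) − 1‖` for `μ < ν` — the two row products differ in exactly one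
factor, by one power of the root. [folklore] -/
theorem norm_hiProd_sub_hiProd_step {h : Site d → Fin d → Fin d → (Matrix n n ℂ)ˣ}
    (hh : ∀ (z : Site d) (κ ν : Fin d), h z κ ν ∈ unitaryUnits (Matrix n n ℂ)) (z : Site d) {q : Site d} {μ ν : Fin d}
    (hμν : μ < ν) (h0 : 0 ≤ q ν) :
    ‖((hiProd h z q μ : (Matrix n n ℂ)ˣ) : (Matrix n n ℂ)) - ((hiProd h z (q + e ν) μ : (Matrix n n ℂ)ˣ) : (Matrix n n ℂ))‖ = ‖((h z μ ν : (Matrix n n ℂ)ˣ) : (Matrix n n ℂ)) - 1‖ := by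
  obtain ⟨l₁, l₂, -, hν₁, hν₂, hsplit⟩ := prodOver_split (G := (Matrix n n ℂ)ˣ) (nodup_above μ) (mem_above.mpr hμν)
  set F : Fin d → (Matrix n n ℂ)ˣ := fun i => ((h z μ i) ^ (q i).toNat)⁻¹ with hF
  set F' : Fin d → (Matrix n n ℂ)ˣ := fun i => ((h z μ i) ^ ((q + e ν) i).toNat)⁻¹ with hF'
  have hagree : ∀ i, i ≠ ν → F' i = F i := fun i hi => by
    simp only [hF, hF', Pi.add_apply, e_apply, if_neg hi, add_zero]
  have h1 : prodOver l₁ F' = prodOver l₁ F := prodOver_congr fun i hi => hagree i (fun he => hν₁ (he ▸ hi))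
  have h2 : prodOver l₂ F' = prodOver l₂ F := prodOver_congr fun i hi => hagree i (fun he => hν₂ (he ▸ hi))
  have hA : hiProd h z q μ = prodOver l₁ F * F ν * prodOver l₂ F := hsplit F
  have hA' : hiProd h z (q + e ν) μ = prodOver l₁ F * F' ν * prodOver l₂ F := by
    rw [show hiProd h z (q + e ν) μ = prodOver (above μ) F' from rfl, hsplit F', h1, h2]
  have hu : ∀ i, F i ∈ unitaryUnits (Matrix n n ℂ) := fun i => (unitaryUnits (Matrix n n ℂ)).inv_mem ((unitaryUnits (Matrix n n ℂ)).pow_mem (hh _ _ _) _)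
  rw [hA, hA', norm_val_frame_sub (prodOver_mem fun i _ => hu i) (prodOver_mem fun i _ => hu i)]
  simp only [hF, hF', toNat_add_e_self h0]
  exact norm_val_powInv_sub_powInv_succ (hh _ _ _) _

/-- **CASE I (INNER PLAQUETTE)** (`μ < ν`, `q_μ, q_ν < L − 1`, other offsets arbitrary): `‖W(∂p) − 1‖ ≤ a₀ + 2θ²`,
`θ = d(L−1)a₀` — the root radius plus ONE commutator (`‖P − 1‖ = ‖AB − BA′‖ ≤ ‖[A,B]‖ + ‖A − A′‖`). [folklore] -/
theorem norm_plaq_inner_sub_one_le {T : Site d → Fin d → (Matrix n n ℂ)ˣ} {h : Site d → Fin d → Fin d → (Matrix n n ℂ)ˣ}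
    (hh : ∀ (z : Site d) (κ ν : Fin d), h z κ ν ∈ unitaryUnits (Matrix n n ℂ))
    (ha : ∀ (z : Site d) (κ ν : Fin d), κ < ν → ‖((h z κ ν : (Matrix n n ℂ)ˣ) : (Matrix n n ℂ)) - 1‖ ≤ a₀) (ha0 : 0 ≤ a₀)
    {z q : Site d} (hq : InBox L q) {μ ν : Fin d} (hμν : μ < ν) (hμ : q μ < (L : ℤ) - 1)
    (hν : q ν < (L : ℤ) - 1) :
    ‖((hol (fullFill L T h) ((L : ℤ) • z + q) (plaqWord μ ν) : (Matrix n n ℂ)ˣ) : (Matrix n n ℂ)) - 1‖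
      ≤ a₀ + 2 * (d * ((L - 1 : ℕ) * a₀)) * (d * ((L - 1 : ℕ) * a₀)) := by
  have huA : ∀ (q' : Site d) (κ : Fin d), hiProd h z q' κ ∈ unitaryUnits (Matrix n n ℂ) := fun q' κ =>
    prodOver_mem fun i _ => (unitaryUnits (Matrix n n ℂ)).inv_mem ((unitaryUnits (Matrix n n ℂ)).pow_mem (hh _ _ _) _)
  rw [hol_plaq_fullFill_inner hq hμν hμ hν, norm_val_plaq4_sub_one (huA _ _) (huA _ _), Units.val_mul, Units.val_mul]
  have hθA := norm_hiProd_sub_one_le hh ha ha0 z hq μ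
  have hθB := norm_hiProd_sub_one_le hh ha ha0 z hq ν
  have hstep := norm_hiProd_sub_hiProd_step hh z hμν (hq ν).1
  calc ‖((hiProd h z q μ : (Matrix n n ℂ)ˣ) : (Matrix n n ℂ)) * ((hiProd h z q ν : (Matrix n n ℂ)ˣ) : (Matrix n n ℂ)) - ((hiProd h z q ν : (Matrix n n ℂ)ˣ) : (Matrix n n ℂ)) * ((hiProd h z (q + e ν) μ : (Matrix n n ℂ)ˣ) : (Matrix n n ℂ))‖
      ≤ ‖((hiProd h z q μ : (Matrix n n ℂ)ˣ) : (Matrix n n ℂ)) * ((hiProd h z q ν : (Matrix n n ℂ)ˣ) : (Matrix n n ℂ)) - ((hiProd h z q ν : (Matrix n n ℂ)ˣ) : (Matrix n n ℂ)) * ((hiProd h z q μ : (Matrix n n ℂ)ˣ) : (Matrix n n ℂ))‖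
        + ‖((hiProd h z q ν : (Matrix n n ℂ)ˣ) : (Matrix n n ℂ)) * ((hiProd h z q μ : (Matrix n n ℂ)ˣ) : (Matrix n n ℂ)) - ((hiProd h z q ν : (Matrix n n ℂ)ˣ) : (Matrix n n ℂ)) * ((hiProd h z (q + e ν) μ : (Matrix n n ℂ)ˣ) : (Matrix n n ℂ))‖ :=
        norm_sub_le_norm_sub_add_norm_sub _ _ _
    _ ≤ 2 * ‖((hiProd h z q μ : (Matrix n n ℂ)ˣ) : (Matrix n n ℂ)) - 1‖ * ‖((hiProd h z q ν : (Matrix n n ℂ)ˣ) : (Matrix n n ℂ)) - 1‖ + ‖((h z μ ν : (Matrix n n ℂ)ˣ) : (Matrix n n ℂ)) - 1‖ := by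
        refine add_le_add (norm_comm_le _ _) (le_of_eq ?_)
        rw [← Units.val_mul, ← Units.val_mul, norm_val_mul_left_sub (huA _ _), hstep]
    _ ≤ 2 * (d * ((L - 1 : ℕ) * a₀)) * (d * ((L - 1 : ℕ) * a₀)) + a₀ := by
        have h1 := mul_le_mul hθA hθB (norm_nonneg _) (le_trans (norm_nonneg _) hθA)
        have h2 := ha z μ ν hμν
        nlinarith [h1, h2]
    _ = _ := by ring

/-- **CASE II (FAR FACE IN `μ`)** (`q_μ = L − 1 > q_ν`…): `‖W(∂p) − 1‖ ≤ a₀ + 2θ² + 2θ_Lθ + d(L−1)δ`, `δ` the covariant root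
gradient across `(z, μ)`: the neighbour's row product `Ad_{Lμ T(z,μ)}(Hν(z+e_μ,q))` is within `d(L−1)δ + 2θ_Lθ` of `Hν(z,q)`.
[folklore] -/
theorem norm_plaq_farμ_sub_one_le (hL : 1 ≤ L) {T : Site d → Fin d → (Matrix n n ℂ)ˣ} {h : Site d → Fin d → Fin d → (Matrix n n ℂ)ˣ}
    (hT : ∀ (z : Site d) (κ : Fin d), T z κ ∈ unitaryUnits (Matrix n n ℂ))
    (hh : ∀ (z : Site d) (κ ν : Fin d), h z κ ν ∈ unitaryUnits (Matrix n n ℂ))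
    (ha : ∀ (z : Site d) (κ ν : Fin d), κ < ν → ‖((h z κ ν : (Matrix n n ℂ)ˣ) : (Matrix n n ℂ)) - 1‖ ≤ a₀) (ha0 : 0 ≤ a₀)
    {z : Site d} {μ : Fin d}
    (hδ : ∀ κ ν : Fin d, κ < ν →
      ‖((T z μ * h (z + e μ) κ ν * (T z μ)⁻¹ : (Matrix n n ℂ)ˣ) : (Matrix n n ℂ)) - ((h z κ ν : (Matrix n n ℂ)ˣ) : (Matrix n n ℂ))‖ ≤ δ) (hδ0 : 0 ≤ δ)
    {q : Site d} (hq : InBox L q) {ν : Fin d} (hμν : μ < ν) (hμ : q μ = (L : ℤ) - 1) (hν : q ν < (L : ℤ) - 1) :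
    ‖((hol (fullFill L T h) ((L : ℤ) • z + q) (plaqWord μ ν) : (Matrix n n ℂ)ˣ) : (Matrix n n ℂ)) - 1‖
      ≤ a₀ + 2 * (d * ((L - 1 : ℕ) * a₀)) * (d * ((L - 1 : ℕ) * a₀))
        + 2 * (d * (((L - 1 : ℕ) * L) * a₀)) * (d * ((L - 1 : ℕ) * a₀)) + d * ((L - 1 : ℕ) * δ) := by
  have huA : ∀ (z' q' : Site d) (κ : Fin d), hiProd h z' q' κ ∈ unitaryUnits (Matrix n n ℂ) := fun z' q' κ =>
    prodOver_mem fun i _ => (unitaryUnits (Matrix n n ℂ)).inv_mem ((unitaryUnits (Matrix n n ℂ)).pow_mem (hh _ _ _) _)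
  have huL : ∀ (q' : Site d) (κ : Fin d), loProd L h z q' κ ∈ unitaryUnits (Matrix n n ℂ) := fun q' κ =>
    prodOver_mem fun i _ => (unitaryUnits (Matrix n n ℂ)).pow_mem (hh _ _ _) _
  -- abbreviations
  set A := hiProd h z q μ with hAdef
  set B := hiProd h z q ν with hBdef
  set A' := hiProd h z (q + e ν) μ with hA'def
  set B₁ := hiProd h (z + e μ) q ν with hB₁def
  set Λ := loProd L h z q μ with hΛdef
  set t := T z μ with htdef
  set M : (Matrix n n ℂ)ˣ := Λ * t * B₁ * (Λ * t)⁻¹ with hMdef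
  have huM' : t * B₁ * t⁻¹ ∈ unitaryUnits (Matrix n n ℂ) :=
    (unitaryUnits (Matrix n n ℂ)).mul_mem ((unitaryUnits (Matrix n n ℂ)).mul_mem (hT _ _) (huA _ _ _)) ((unitaryUnits (Matrix n n ℂ)).inv_mem (hT _ _))
  -- the word, regrouped as `A M A'⁻¹ B⁻¹`
  have hword : hiProd h z q μ * (loProd L h z q μ * T z μ) * hiProd h (z + e μ) q ν
      * ((loProd L h z q μ * T z μ)⁻¹ * (hiProd h z (q + e ν) μ)⁻¹) * (hiProd h z q ν)⁻¹
      = A * M * A'⁻¹ * B⁻¹ := by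
    simp only [hMdef, hAdef, hBdef, hA'def, hB₁def, hΛdef, htdef]; group
  rw [hol_plaq_fullFill_farμ hL hq hμν hμ hν, hword, norm_val_plaq4_sub_one (huA _ _ _) (huA _ _ _),
    Units.val_mul, Units.val_mul]
  -- sizes
  have hθA : ‖(A : (Matrix n n ℂ)) - 1‖ ≤ d * ((L - 1 : ℕ) * a₀) := norm_hiProd_sub_one_le hh ha ha0 z hq μ
  have hθB : ‖(B : (Matrix n n ℂ)) - 1‖ ≤ d * ((L - 1 : ℕ) * a₀) := norm_hiProd_sub_one_le hh ha ha0 z hq ν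
  have hθΛ : ‖(Λ : (Matrix n n ℂ)) - 1‖ ≤ d * (((L - 1 : ℕ) * L) * a₀) := norm_loProd_sub_one_le hh ha ha0 z hq μ
  have hθB₁ : ‖((t * B₁ * t⁻¹ : (Matrix n n ℂ)ˣ) : (Matrix n n ℂ)) - 1‖ ≤ d * ((L - 1 : ℕ) * a₀) := by
    have e1 : ((t * B₁ * t⁻¹ : (Matrix n n ℂ)ˣ) : (Matrix n n ℂ)) - 1 = ((t * B₁ * t⁻¹ : (Matrix n n ℂ)ˣ) : (Matrix n n ℂ)) - ((t * 1 * t⁻¹ : (Matrix n n ℂ)ˣ) : (Matrix n n ℂ)) := by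
      rw [mul_one, mul_inv_cancel, Units.val_one]
    rw [e1, norm_val_frame_sub (hT _ _) ((unitaryUnits (Matrix n n ℂ)).inv_mem (hT _ _)), Units.val_one]
    exact norm_hiProd_sub_one_le hh ha ha0 (z + e μ) hq ν
  have hδB : ‖((t * B₁ * t⁻¹ : (Matrix n n ℂ)ˣ) : (Matrix n n ℂ)) - (B : (Matrix n n ℂ))‖ ≤ d * ((L - 1 : ℕ) * δ) :=
    norm_conj_hiProd_sub_le hh (hT _ _) hδ hδ0 hq ν
  have hstep := norm_hiProd_sub_hiProd_step hh z hμν (hq ν).1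
  -- `‖M − B‖ ≤ 2θ_Lθ + d(L−1)δ`
  have hMB : ‖(M : (Matrix n n ℂ)) - (B : (Matrix n n ℂ))‖ ≤ 2 * (d * (((L - 1 : ℕ) * L) * a₀)) * (d * ((L - 1 : ℕ) * a₀)) + d * ((L - 1 : ℕ) * δ) := by
    have e1 : M = Λ * (t * B₁ * t⁻¹) * Λ⁻¹ := by rw [hMdef]; group
    calc ‖(M : (Matrix n n ℂ)) - (B : (Matrix n n ℂ))‖ ≤ ‖(M : (Matrix n n ℂ)) - ((t * B₁ * t⁻¹ : (Matrix n n ℂ)ˣ) : (Matrix n n ℂ))‖ + ‖((t * B₁ * t⁻¹ : (Matrix n n ℂ)ˣ) : (Matrix n n ℂ)) - (B : (Matrix n n ℂ))‖ :=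
          norm_sub_le_norm_sub_add_norm_sub _ _ _
      _ ≤ 2 * ‖(Λ : (Matrix n n ℂ)) - 1‖ * ‖((t * B₁ * t⁻¹ : (Matrix n n ℂ)ˣ) : (Matrix n n ℂ)) - 1‖ + d * ((L - 1 : ℕ) * δ) := by
          rw [e1]; exact add_le_add (norm_val_conj_sub_le (huL _ _) _) hδB
      _ ≤ _ := by
          have h1 := mul_le_mul hθΛ hθB₁ (norm_nonneg _) (le_trans (norm_nonneg _) hθΛ)
          nlinarith [h1]
  calc ‖(A : (Matrix n n ℂ)) * (M : (Matrix n n ℂ)) - (B : (Matrix n n ℂ)) * (A' : (Matrix n n ℂ))‖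
      ≤ ‖(A : (Matrix n n ℂ)) * (M : (Matrix n n ℂ)) - (A : (Matrix n n ℂ)) * (B : (Matrix n n ℂ))‖ + ‖(A : (Matrix n n ℂ)) * (B : (Matrix n n ℂ)) - (B : (Matrix n n ℂ)) * (A' : (Matrix n n ℂ))‖ :=
        norm_sub_le_norm_sub_add_norm_sub _ _ _
    _ ≤ ‖(M : (Matrix n n ℂ)) - (B : (Matrix n n ℂ))‖ + (‖(A : (Matrix n n ℂ)) * (B : (Matrix n n ℂ)) - (B : (Matrix n n ℂ)) * (A : (Matrix n n ℂ))‖ + ‖(B : (Matrix n n ℂ)) * (A : (Matrix n n ℂ)) - (B : (Matrix n n ℂ)) * (A' : (Matrix n n ℂ))‖) := by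
        refine add_le_add (le_of_eq ?_) (norm_sub_le_norm_sub_add_norm_sub _ _ _)
        rw [← Units.val_mul, ← Units.val_mul, norm_val_mul_left_sub (huA _ _ _)]
    _ ≤ (2 * (d * (((L - 1 : ℕ) * L) * a₀)) * (d * ((L - 1 : ℕ) * a₀)) + d * ((L - 1 : ℕ) * δ))
        + (2 * ‖(A : (Matrix n n ℂ)) - 1‖ * ‖(B : (Matrix n n ℂ)) - 1‖ + ‖((h z μ ν : (Matrix n n ℂ)ˣ) : (Matrix n n ℂ)) - 1‖) := by
        refine add_le_add hMB (add_le_add (norm_comm_le _ _) (le_of_eq ?_))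
        rw [← Units.val_mul, ← Units.val_mul, norm_val_mul_left_sub (huA _ _ _), hAdef, hA'def, hstep]
    _ ≤ (2 * (d * (((L - 1 : ℕ) * L) * a₀)) * (d * ((L - 1 : ℕ) * a₀)) + d * ((L - 1 : ℕ) * δ))
        + (2 * (d * ((L - 1 : ℕ) * a₀)) * (d * ((L - 1 : ℕ) * a₀)) + a₀) := by
        have h1 := mul_le_mul hθA hθB (norm_nonneg _) (le_trans (norm_nonneg _) hθA)
        have h2 := ha z μ ν hμν
        nlinarith [h1, h2]
    _ = _ := by ring

end Plaquettes

end

end Summit.QuantumFields.BalabanUV.T4Continuum.SkeletonFillFullNorms
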